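import Summits.BirchSwinnertonDyer.BirchSwinnertonDyer.Theorems.EisensteinPrimesMazurMCOnCellBTwistbackTwoStepShaUnit
import Summits.BirchSwinnertonDyer.BirchSwinnertonDyer.Theorems.GenusKolyvaginAtTwoGenusPrimitiveSupplyAtTwoHeegnerTwinTamagawaOdd
import Literature.NumberTheory.QuadraticFields.QuadraticDedekindZeta
import HarnessLib

/-!
# Crux 3 `MazurMCOnCellB` (stmt-BirchSwinnertonDyer-19033), line `twistback` v6 — ROAD (e) with the second field's
# admissibility READ ON `(N_W, d_K)`: the Heegner hypothesis for the partner's conductor `N_{Wd}` follows from the Heegner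
# hypotheses for `N_W` and for `|d_K|` (bad primes of a twist by `d ≡ 1 (mod 4)` divide `N_W · d`)

Width seat bsd-line-x2-p1-w6 (gen 2), cell `bsd-eis`, 2026-08-28; `--supports stmt-BirchSwinnertonDyer-19033 --as helper`; sequel
of p662647 `…TwistbackTwoStepShaUnit`. HONEST FRAMING: conditional theorems only; no `def`, no named fact introduced, no `sorry`;
closes no registered stub; no summit statement, no Mazur main conjecture and no BSD is proved for any curve; 0 cells / labels /
stubs / tiers move.

WHY: in p662647 the second admissible field `K″` is asked to be Heegner for `Wd.conductorNorm ℤ` — the conductor of the (large)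
twist `Wd ≅ E^{(d_K)}`, which in a per-cell display is an extra READING. Here it is DERIVED: every prime `q ∣ N_{Wd}` is a prime of
bad reduction of `Wd` (`dvd_conductorNorm_iff_not_hasGoodReductionAtPrime`, Diamond–Shurman §8.3), hence `q ∣ d_K` or a prime of bad
reduction of `W` (`GenusKolyTwin.hasGoodReductionAtPrime_twist_of_not_dvd`: a model of `E^{(d)}`, `d ≡ 1 (mod 4)`, is good at every
good prime of `E` not dividing `d` — Silverman ATAEC IV.9.4), hence `q ∣ d_K` or `q ∣ N_W`; so Heegner for `N_W` and for `|d_K|`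
give Heegner for `N_{Wd}` (§1). §2 rewrites road (e)'s ∃-PARTNER clause and per-pair main conjecture (p662647 §2–§3) with the
second field's conditions stated on `(N_W, p, |d_K|)` only — per cell three Kronecker-symbol checks, as in lam-a's
`satisfiesHeegnerHypothesis_5568` / `_3`.

References: [DiamondShurman2005] §8.3; [SilvermanATAEC1994] IV.9.4; [GrossLMS1991] §1; [KellerYin2024] Thm. D (PRE);
[Wuthrich2014] Prop. 21; [Miller2011LMS] Def. 1.1.
-/

set_option autoImplicit false
-- `Summit.BirchSwinnertonDyer.BirchSwinnertonDyer.…`: the summit and its single sub-problem share a name.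
set_option linter.dupNamespace false

noncomputable section

open scoped Classical MatrixGroups ModularForm

open CongruenceSubgroup WeierstrassCurve NumberField
  Literature.NumberTheory.EllipticCurves
  Literature.NumberTheory.EllipticCurves.ModularForms
  Literature.NumberTheory.QuadraticFields
  Literature.NumberTheory.EllipticCurves.Rank1Residual
  Literature.NumberTheory.EllipticCurves.Rank1Residual.Typed
  Literature.NumberTheory.EllipticCurves.Wuthrich2014
  Literature.NumberTheory.EllipticCurves.KellerYin2024
  Literature.NumberTheory.GaloisCohomology
  Summit.BirchSwinnertonDyer.Rank1Residual
  Summit.BirchSwinnertonDyer.BirchSwinnertonDyer.Theses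
  Summit.BirchSwinnertonDyer.BirchSwinnertonDyer.Theorems.EisensteinPrimesMazurMCOnCellBTwistbackTwoStepShaUnit

namespace Summit.BirchSwinnertonDyer.BirchSwinnertonDyer.Theorems.EisensteinPrimesMazurMCOnCellBTwistbackTwoStepShaUnitLevel

/-! ## §1. The Heegner hypothesis for the conductor of a twist from the hypotheses for `N_W` and `|d|` -/

/-- **Bad primes of a quadratic twist divide `N_W · d`**: for `W/ℚ` elliptic, `d ≡ 1 (mod 4)` and any elliptic model `Wd` of
`E^{(d)}` (`C • Wd = W.quadraticTwist d`), every prime `q ∣ N_{Wd}` divides `d` or `N_W` — `q ∣ N ⟺` bad reduction at `q`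
(Diamond–Shurman §8.3) and the twist is good at the good primes of `W` off `d` (Silverman ATAEC IV.9.4, tree
`GenusKolyTwin.hasGoodReductionAtPrime_twist_of_not_dvd`). [cite: DiamondShurman2005, §8.3 (PDF p. 353)] [cite: SilvermanATAEC1994, IV.9.4] -/
theorem dvd_or_dvd_conductorNorm_of_dvd_conductorNorm_twist (W : WeierstrassCurve ℚ) [W.IsElliptic] {d : ℤ} (hd4 : d % 4 = 1)
    (Wd : WeierstrassCurve ℚ) [Wd.IsElliptic] (C : VariableChange ℚ) (hC : C • Wd = W.quadraticTwist (d : ℚ))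
    {q : ℕ} (hq : q.Prime) (hqN : q ∣ Wd.conductorNorm ℤ) : (q : ℤ) ∣ d ∨ q ∣ W.conductorNorm ℤ := by
  haveI : Fact q.Prime := ⟨hq⟩
  by_cases hqd : (q : ℤ) ∣ d
  · exact Or.inl hqd
  · refine Or.inr ?_
    by_contra hqNW
    have hgood : W.HasGoodReductionAtPrime q := by
      by_contra hbad
      exact hqNW ((W.dvd_conductorNorm_iff_not_hasGoodReductionAtPrime q).mpr hbad)
    have hC' : C⁻¹ • W.quadraticTwist (d : ℚ) = Wd := by rw [← hC, inv_smul_smul]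
    have hgoodd : Wd.HasGoodReductionAtPrime q :=
      GenusKolyTwin.hasGoodReductionAtPrime_twist_of_not_dvd W hd4 C⁻¹ hC' q hgood hqd
    exact (Wd.dvd_conductorNorm_iff_not_hasGoodReductionAtPrime q).mp hqN hgoodd

/-- **Heegner for `N_W` and for `|d|` ⟹ Heegner for `N_{Wd}`** (`Wd` any elliptic model of `E^{(d)}`, `d ≡ 1 (mod 4)`): by
`dvd_or_dvd_conductorNorm_of_dvd_conductorNorm_twist`, every prime of the twist's conductor divides `d` or `N_W`, where the field
is split by hypothesis. [cite: GrossLMS1991, §1 (p. 235)] [cite: DiamondShurman2005, §8.3 (PDF p. 353)] -/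
theorem satisfiesHeegnerHypothesis_conductorNorm_twist (W : WeierstrassCurve ℚ) [W.IsElliptic] {d : ℤ} (hd4 : d % 4 = 1)
    (Wd : WeierstrassCurve ℚ) [Wd.IsElliptic] (C : VariableChange ℚ) (hC : C • Wd = W.quadraticTwist (d : ℚ))
    {L : Type} [Field L] [NumberField L] (hN : SatisfiesHeegnerHypothesis (W.conductorNorm ℤ) L)
    (hd : SatisfiesHeegnerHypothesis d.natAbs L) : SatisfiesHeegnerHypothesis (Wd.conductorNorm ℤ) L := by
  intro q hq hqN
  rcases dvd_or_dvd_conductorNorm_of_dvd_conductorNorm_twist W hd4 Wd C hC hq hqN with hqd | hqW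
  · exact hd q hq (Int.natCast_dvd_natCast.mp (Int.dvd_natAbs.mpr hqd))
  · exact hN q hq hqW

/-! ## §2. Road (e) with the second field read on `(N_W, p, |d_K|)` -/

/-- **Stub 6′ (∃-PARTNER) AT `(W, p)` from a TWO-STEP UNIT datum, the second field's admissibility stated on `N_W`, `p` and
`|d_K|`** — p662647 §2 `upperPartner_at_of_twoStepShaUnit` with `SatisfiesHeegnerHypothesis (Wd.conductorNorm ℤ) K″` DERIVED
from `SatisfiesHeegnerHypothesis (W.conductorNorm ℤ) K″` and `SatisfiesHeegnerHypothesis |d_K| K″` (§1; `d_K ≡ 1 (mod 4)` for an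
imaginary quadratic `K` of odd discriminant, `Quadratic.discr_emod_four_eq_one`). Named facts BY NAME as there (`PublishedInputs`,
Wuthrich Prop. 21, Poitou–Tate ×2, Hsieh, LZZ, Mazur Cor. 4.1, Keller–Yin Thm. D [PRE]). CONDITIONAL; nothing class-wide is claimed.
[claim: KellerYin2024, status: under-review] [cite: KellerYin2024, Thm. D = Thm. 5.1.3 (arXiv:2402.12781v2 L306–L309)]
[cite: Wuthrich2014, Prop. 21 (p. 400)] [cite: GrossLMS1991, §1 (p. 235)] [cite: Miller2011LMS, Def. 1.1] -/
theorem upperPartner_at_of_twoStepShaUnit_of_levels (hP : EisensteinPrimes.PublishedInputs) (hW21 : sha_dvd_analyticSha)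
    (hPT : ∀ (K : Type) [Field K] [NumberField K], poitouTate_selmerStructure_duality K)
    (hPT2 : ∀ (K : Type) [Field K] [NumberField K], poitouTate_sha_tateDual K)
    (hH : hsieh2014_exists_anticyclotomicPAdicLFunction)
    (hF : LiuZhangZhang2018.thm151_thm153_modularCurve_heegnerVector) (hMaz : mazur_not_dvd_maninConstant_of_odd)
    (hD : KellerYin2024.thmD_imcMult_exists_isBDPLFunction_isTorsion_charIdeal_eq_OPEN)
    (W : WeierstrassCurve ℚ) [W.IsElliptic] [W.IsGloballyMinimal] (p : ℕ) [Fact p.Prime] (hc : X2.CellB W p)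
    (K : Type) [Field K] [NumberField K] (hK : IsImaginaryQuadratic K)
    (hHN : SatisfiesHeegnerHypothesis (W.conductorNorm ℤ) K) (hHp : SatisfiesHeegnerHypothesis p K)
    (hoddK : Odd (NumberField.discr K)) (hlt : NumberField.discr K < -4)
    (hr1 : (W.quadraticTwist (NumberField.discr K : ℚ)).analyticRank = 1)
    (Wd : WeierstrassCurve ℚ) [Wd.IsElliptic] [Wd.IsGloballyMinimal]
    (hWd : ∃ C : VariableChange ℚ, C • Wd = W.quadraticTwist (NumberField.discr K : ℚ))
    (K'' : Type) [Field K''] [NumberField K''] (hK'' : IsImaginaryQuadratic K'')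
    (hodd'' : Odd (NumberField.discr K'')) (hlt'' : NumberField.discr K'' < -4)
    (hHN'' : SatisfiesHeegnerHypothesis (W.conductorNorm ℤ) K'')
    (hHd'' : SatisfiesHeegnerHypothesis (NumberField.discr K).natAbs K'') (hHp'' : SatisfiesHeegnerHypothesis p K'')
    (hL'' : (Wd.quadraticTwist (NumberField.discr K'' : ℚ)).entireLFunction 1 ≠ 0)
    (W'' : WeierstrassCurve ℚ) [W''.IsElliptic] [W''.IsGloballyMinimal]
    (hW'' : ∃ C : VariableChange ℚ, C • W'' = Wd.quadraticTwist (NumberField.discr K'' : ℚ))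
    (hunit : ∃ q : ℚ, shaAn W'' = (q : ℂ) ∧ padicValRat p q = 0) :
    ∃ (K : Type) (_ : Field K) (_ : NumberField K), IsImaginaryQuadratic K ∧
      SatisfiesHeegnerHypothesis (W.conductorNorm ℤ) K ∧ SatisfiesHeegnerHypothesis p K ∧
      Odd (NumberField.discr K) ∧ NumberField.discr K < -4 ∧
      (W.quadraticTwist (NumberField.discr K : ℚ)).analyticRank = 1 ∧
      ∀ (Wd : WeierstrassCurve ℚ) [Wd.IsElliptic] [Wd.IsGloballyMinimal],
        (∃ C : VariableChange ℚ, C • Wd = W.quadraticTwist (NumberField.discr K : ℚ)) →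
        MissingUpperBoundAt Wd p := by
  obtain ⟨C, hC⟩ := hWd
  have hd4 : NumberField.discr K % 4 = 1 := Quadratic.discr_emod_four_eq_one hK.1 hoddK
  have hHNd : SatisfiesHeegnerHypothesis (Wd.conductorNorm ℤ) K'' :=
    satisfiesHeegnerHypothesis_conductorNorm_twist W hd4 Wd C hC hHN'' hHd''
  exact upperPartner_at_of_twoStepShaUnit hP hW21 hPT hPT2 hH hF hMaz hD W p hc K hK hHN hHp hoddK hlt hr1 Wd ⟨C, hC⟩
    K'' hK'' hodd'' hlt'' hHNd hHp'' hL'' W'' hW'' hunit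

/-- **PER PAIR: Mazur's main conjecture at `(W, p)` from a TWO-STEP UNIT datum, the second field read on `(N_W, p, |d_K|)`** —
p662647 §3 `mazurMainConjectureAt_of_cellB_of_twoStepShaUnit` with the Heegner hypothesis for `N_{Wd}` DERIVED (§1). Same binders
as `upperPartner_at_of_twoStepShaUnit_of_levels`. CONDITIONAL; a main conjecture is proved for no curve by this.
[claim: KellerYin2024, status: under-review] [cite: KellerYin2024, Thm. D = Thm. 5.1.3 (arXiv:2402.12781v2 L306–L309)]
[cite: Wuthrich2014, Thm. 16 (p. 397) and Prop. 21 (p. 400)] [cite: GrossLMS1991, §1 (p. 235)] [cite: Miller2011LMS, Def. 1.1] -/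
theorem mazurMainConjectureAt_of_cellB_of_twoStepShaUnit_of_levels (hP : EisensteinPrimes.PublishedInputs)
    (hW21 : sha_dvd_analyticSha)
    (hPT : ∀ (K : Type) [Field K] [NumberField K], poitouTate_selmerStructure_duality K)
    (hPT2 : ∀ (K : Type) [Field K] [NumberField K], poitouTate_sha_tateDual K)
    (hH : hsieh2014_exists_anticyclotomicPAdicLFunction)
    (hF : LiuZhangZhang2018.thm151_thm153_modularCurve_heegnerVector) (hMaz : mazur_not_dvd_maninConstant_of_odd)
    (hD : KellerYin2024.thmD_imcMult_exists_isBDPLFunction_isTorsion_charIdeal_eq_OPEN)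
    (W : WeierstrassCurve ℚ) [W.IsElliptic] [W.IsGloballyMinimal] (p : ℕ) [Fact p.Prime] (hc : X2.CellB W p)
    (K : Type) [Field K] [NumberField K] (hK : IsImaginaryQuadratic K)
    (hHN : SatisfiesHeegnerHypothesis (W.conductorNorm ℤ) K) (hHp : SatisfiesHeegnerHypothesis p K)
    (hoddK : Odd (NumberField.discr K)) (hlt : NumberField.discr K < -4)
    (hr1 : (W.quadraticTwist (NumberField.discr K : ℚ)).analyticRank = 1)
    (Wd : WeierstrassCurve ℚ) [Wd.IsElliptic] [Wd.IsGloballyMinimal]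
    (hWd : ∃ C : VariableChange ℚ, C • Wd = W.quadraticTwist (NumberField.discr K : ℚ))
    (K'' : Type) [Field K''] [NumberField K''] (hK'' : IsImaginaryQuadratic K'')
    (hodd'' : Odd (NumberField.discr K'')) (hlt'' : NumberField.discr K'' < -4)
    (hHN'' : SatisfiesHeegnerHypothesis (W.conductorNorm ℤ) K'')
    (hHd'' : SatisfiesHeegnerHypothesis (NumberField.discr K).natAbs K'') (hHp'' : SatisfiesHeegnerHypothesis p K'')
    (hL'' : (Wd.quadraticTwist (NumberField.discr K'' : ℚ)).entireLFunction 1 ≠ 0)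
    (W'' : WeierstrassCurve ℚ) [W''.IsElliptic] [W''.IsGloballyMinimal]
    (hW'' : ∃ C : VariableChange ℚ, C • W'' = Wd.quadraticTwist (NumberField.discr K'' : ℚ))
    (hunit : ∃ q : ℚ, shaAn W'' = (q : ℂ) ∧ padicValRat p q = 0) : X2.MazurMainConjectureAt W p := by
  obtain ⟨C, hC⟩ := hWd
  have hd4 : NumberField.discr K % 4 = 1 := Quadratic.discr_emod_four_eq_one hK.1 hoddK
  have hHNd : SatisfiesHeegnerHypothesis (Wd.conductorNorm ℤ) K'' :=
    satisfiesHeegnerHypothesis_conductorNorm_twist W hd4 Wd C hC hHN'' hHd''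
  exact mazurMainConjectureAt_of_cellB_of_twoStepShaUnit hP hW21 hPT hPT2 hH hF hMaz hD W p hc K hK hHN hHp hoddK hlt
    hr1 Wd ⟨C, hC⟩ K'' hK'' hodd'' hlt'' hHNd hHp'' hL'' W'' hW'' hunit

end Summit.BirchSwinnertonDyer.BirchSwinnertonDyer.Theorems.EisensteinPrimesMazurMCOnCellBTwistbackTwoStepShaUnitLevel

end
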